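import Summits.QuantumFields.YangMills.Theorems.LuscherReductionRunningReductionActionPhase
import Summits.QuantumFields.YangMills.Theorems.FemtoTransferGapAxisPermutation
import Summits.QuantumFields.YangMills.Theorems.SwapTwistDeficitFlatSheetDefs
import HarnessLib

/-!
# Flat-sheet geometry on `SU(2)^{E}` over `(ℤ/L)³`: the transfer kernel near a FLAT reference configuration, the flat «sheet»
# configuration with non-central `x`-holonomy, and the `x`-Polyakov distance-to-centre functional

Support module for the FIXED-LATTICE rungs (BC5 witnesses, «r1 at every fixed `L`») of the trace-door cruxes of seat ym-idea-4:
K2a `ThermalTraceWindow.SubFemtoFirstLevel` (item stmt-QuantumFields-28291) and `SwapTwistDeficit.TwistDeficit` (stmt-QuantumFields-23317).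
Both rungs rest on ONE localised physical trial function; this file supplies its geometry, for every `L ≥ 1` and `β ≥ 0`:

* §1 near-flat algebra (generalising `…LatticeTopLower` §1 from the identity to ANY flat reference `W`, all plaquette holonomies `= 1`; the
  two-factor bounds `frobNorm_mul_sub_mul_le` ∕ `frobNorm_inv_sub_inv` are the tree's): `‖U_p − W_p‖_F ≤ Σ_{e∈p} ‖U_e − W_e‖_F ≤ 4r` on the Hilbert–Schmidt box `A_r(W) = {U | ∀e, ‖U_e − W_e‖_F ≤ r}`, hence `S(U) ≤ 8r²|P|`
  there, and ★ `transferKernel_ge_of_near_flat`: `K_β(U,V) ≥ e^{−β·8r²|P|} · e^{β(2−2r²)|E|}` on `A_r(W) × A_r(W)`;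
* §2 `Haar^{⊗E}(A_r(W)) = ballVol(r)^{|E|}` (translation invariance of the one-link ball volume, `ballVol_shift`);
* §3 the separation bound: ONE link with `‖U_e − V_e‖_F ≥ ρ` forces `Σ_e Re tr(U_eV_e⁻¹) ≤ 2|E| − ρ²/2`, hence `K_β(U,V) ≤ e^{β(2|E| − ρ²/2)}`;
* §4 the flat SHEET configuration `sheetCfg L = twist 0 (diagSU2 (π/2)) 1` of `…FlatSheetDefs` (the `x`-links issuing from the plane `x₀ = 0`
  equal `diag(i,−i)`, at Hilbert–Schmidt distance `2` from both centre elements; all other links `1`): all its plaquette holonomies are `1`;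

The `x`-Polyakov holonomy functional `polDist` and the trial function `sheetTrial` are treated in the companion modules.

HONEST FRAMING: fixed-lattice matrix bookkeeping (any `L`, any `β ≥ 0`); no semiclassics, no renormalisation group; the rungs it serves are
finite-dimensional witnesses for DRAFT lines onto a RECORD rung (K2a ⟶ R2ξ″) — nothing here bears on infinite volume, the continuum limit or the
Clay Yang–Mills gap.  No `sorry`, no new axiom, no new definition (the objects are those of `…SwapTwistDeficitFlatSheetDefs`).
References: [cite: Luscher1983, §2] (torons / flat connections on the torus, centre twists); [cite: SeilerLNP1982, §3] (temporal-gauge transfer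
kernel); [cite: ReedSimonIV1978, Thm. XIII.1] (min–max, downstream).
-/

set_option autoImplicit false

noncomputable section

open MeasureTheory Filter Topology Real
open scoped Matrix ComplexConjugate BigOperators
open Literature.MathematicalPhysics.QuantumFieldTheory
open Literature.MathematicalPhysics.QuantumLattice

namespace Summit.QuantumFields.YangMills.Theorems.FemtoTransferGap

namespace FlatSheet

variable {L : ℕ}

/-! ## §1 Near-flat algebra: the kernel on a Hilbert–Schmidt box around a flat configuration -/

/-- A plaquette holonomy moves by at most the sum of the four link displacements: `‖U_p − W_p‖_F ≤ 4r` when `‖U_e − W_e‖_F ≤ r` for all `e`.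
[folklore] -/
theorem frobNorm_plaquetteHolonomy_sub_le_of_forall (U W : GaugeConfig 3 L SU2) {r : ℝ}
    (hr : ∀ e, frobNorm ((U e : Matrix (Fin 2) (Fin 2) ℂ) - (W e : Matrix (Fin 2) (Fin 2) ℂ)) ≤ r) (x : Site 3 L) (i j : Fin 3) :
    frobNorm (((plaquetteHolonomy U x i j : SU2) : Matrix (Fin 2) (Fin 2) ℂ) - ((plaquetteHolonomy W x i j : SU2) : Matrix (Fin 2) (Fin 2) ℂ)) ≤
      4 * r := by
  unfold plaquetteHolonomy
  have h1 := frobNorm_mul_sub_mul_le (U (x, i) * U (x.shift i, j) * (U (x.shift j, i))⁻¹) (U (x, j))⁻¹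
    (W (x, i) * W (x.shift i, j) * (W (x.shift j, i))⁻¹) (W (x, j))⁻¹
  have h2 := frobNorm_mul_sub_mul_le (U (x, i) * U (x.shift i, j)) (U (x.shift j, i))⁻¹ (W (x, i) * W (x.shift i, j)) (W (x.shift j, i))⁻¹
  have h3 := frobNorm_mul_sub_mul_le (U (x, i)) (U (x.shift i, j)) (W (x, i)) (W (x.shift i, j))
  rw [frobNorm_inv_sub_inv] at h1 h2
  linarith [hr (x, i), hr (x.shift i, j), hr (x.shift j, i), hr (x, j)]

/-- One plaquette term is `≤ 8r²` on the box around a FLAT reference (`W_p = 1`). [folklore] -/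
theorem plaquetteTerm_le_of_near_flat (U W : GaugeConfig 3 L SU2) (hflat : ∀ (x : Site 3 L) (i j : Fin 3), plaquetteHolonomy W x i j = 1)
    {r : ℝ} (hr : ∀ e, frobNorm ((U e : Matrix (Fin 2) (Fin 2) ℂ) - (W e : Matrix (Fin 2) (Fin 2) ℂ)) ≤ r) (x : Site 3 L) (i j : Fin 3) :
    2 - ((su2Rep (plaquetteHolonomy U x i j)).trace).re ≤ 8 * r ^ 2 := by
  rw [fundamentalRep_apply, two_sub_re_trace_eq]
  have h := frobNorm_plaquetteHolonomy_sub_le_of_forall U W hr x i j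
  rw [hflat x i j, OneMemClass.coe_one] at h
  have h0 : 0 ≤ frobNorm (((plaquetteHolonomy U x i j : SU2) : Matrix (Fin 2) (Fin 2) ℂ) - 1) := frobNorm_nonneg _
  have hsq := mul_le_mul h h h0 (by linarith)
  nlinarith

/-- **The magnetic energy is small on the box around a flat configuration**: `S(U) ≤ 8r²|P|`. [folklore] -/
theorem wilsonAction_le_of_near_flat [NeZero L] (U W : GaugeConfig 3 L SU2)
    (hflat : ∀ (x : Site 3 L) (i j : Fin 3), plaquetteHolonomy W x i j = 1)
    {r : ℝ} (hr : ∀ e, frobNorm ((U e : Matrix (Fin 2) (Fin 2) ℂ) - (W e : Matrix (Fin 2) (Fin 2) ℂ)) ≤ r) :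
    wilsonAction su2Rep U ≤ 8 * r ^ 2 * Fintype.card (Plaquette 3 L) := by
  have h1 : wilsonAction su2Rep U = ∑ p : Plaquette 3 L, (2 - ((su2Rep (plaquetteHolonomy U p.1 p.2.1.1 p.2.1.2)).trace).re) := by
    unfold wilsonAction; simp
  rw [h1]
  calc ∑ p : Plaquette 3 L, (2 - ((su2Rep (plaquetteHolonomy U p.1 p.2.1.1 p.2.1.2)).trace).re)
      ≤ ∑ _p : Plaquette 3 L, (8 * r ^ 2 : ℝ) := Finset.sum_le_sum fun p _ => plaquetteTerm_le_of_near_flat U W hflat hr _ _ _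
    _ = 8 * r ^ 2 * Fintype.card (Plaquette 3 L) := by
        rw [Finset.sum_const, Finset.card_univ, nsmul_eq_mul]; ring

/-- A one-link weight with `‖u − v‖_F ≤ 2r` is `≥ e^{β(2 − 2r²)}` (`Re tr(uv⁻¹) = 2 − ‖u − v‖_F²/2`). [folklore] -/
theorem linkW_ge_of_frobNorm_sub_le {β : ℝ} (hβ : 0 ≤ β) {r : ℝ} {u v : SU2}
    (h : frobNorm ((u : Matrix (Fin 2) (Fin 2) ℂ) - (v : Matrix (Fin 2) (Fin 2) ℂ)) ≤ 2 * r) :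
    Real.exp (β * (2 - 2 * r ^ 2)) ≤ linkW β (u * v⁻¹) := by
  unfold linkW
  refine Real.exp_le_exp.2 (mul_le_mul_of_nonneg_left ?_ hβ)
  rw [frobNorm_sub_eq_mul_inv] at h
  have h0 : 0 ≤ frobNorm (((u * v⁻¹ : SU2) : Matrix (Fin 2) (Fin 2) ℂ) - 1) := frobNorm_nonneg _
  have htr := two_sub_re_trace_eq (u * v⁻¹)
  have hsq := mul_le_mul h h h0 (by linarith)
  nlinarith

/-- On `A_r(W) × A_r(W)` the electric factor is `≥ e^{β(2−2r²)|E|}`. [folklore] -/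
theorem latE_ge_of_near [NeZero L] {β : ℝ} (hβ : 0 ≤ β) {r : ℝ} {U V W : GaugeConfig 3 L SU2}
    (hU : ∀ e, frobNorm ((U e : Matrix (Fin 2) (Fin 2) ℂ) - (W e : Matrix (Fin 2) (Fin 2) ℂ)) ≤ r)
    (hV : ∀ e, frobNorm ((V e : Matrix (Fin 2) (Fin 2) ℂ) - (W e : Matrix (Fin 2) (Fin 2) ℂ)) ≤ r) :
    Real.exp (β * (2 - 2 * r ^ 2)) ^ Fintype.card (Edge 3 L) ≤ latE L β U V := by
  unfold latE
  rw [← Finset.card_univ, ← Finset.prod_const]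
  refine Finset.prod_le_prod (fun e _ => (Real.exp_pos _).le) fun e _ => linkW_ge_of_frobNorm_sub_le hβ ?_
  calc frobNorm ((U e : Matrix (Fin 2) (Fin 2) ℂ) - (V e : Matrix (Fin 2) (Fin 2) ℂ))
      ≤ frobNorm ((U e : Matrix (Fin 2) (Fin 2) ℂ) - (W e : Matrix (Fin 2) (Fin 2) ℂ)) +
          frobNorm ((W e : Matrix (Fin 2) (Fin 2) ℂ) - (V e : Matrix (Fin 2) (Fin 2) ℂ)) := frobNorm_sub_le _ _ _
    _ ≤ r + r := add_le_add (hU e) (by rw [frobNorm_sub_comm]; exact hV e)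
    _ = 2 * r := by ring

/-- ★ **The transfer kernel on the box around a flat configuration**: if every plaquette holonomy of `W` is `1` and `U, V ∈ A_r(W)`, then
`K_β(U,V) ≥ e^{−β·8r²|P|} · e^{β(2−2r²)|E|}` — the same bound as about the identity (`transferKernel_ge_of_near_one`). [cite: SeilerLNP1982, §3] -/
theorem transferKernel_ge_of_near_flat [NeZero L] {β : ℝ} (hβ : 0 ≤ β) {r : ℝ} {U V W : GaugeConfig 3 L SU2}
    (hflat : ∀ (x : Site 3 L) (i j : Fin 3), plaquetteHolonomy W x i j = 1)
    (hU : ∀ e, frobNorm ((U e : Matrix (Fin 2) (Fin 2) ℂ) - (W e : Matrix (Fin 2) (Fin 2) ℂ)) ≤ r)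
    (hV : ∀ e, frobNorm ((V e : Matrix (Fin 2) (Fin 2) ℂ) - (W e : Matrix (Fin 2) (Fin 2) ℂ)) ≤ r) :
    Real.exp (-(β * (8 * r ^ 2 * Fintype.card (Plaquette 3 L)))) * Real.exp (β * (2 - 2 * r ^ 2)) ^ Fintype.card (Edge 3 L) ≤
      transferKernel su2Rep β U V :=
  (mul_le_mul_of_nonneg_left (latE_ge_of_near hβ hU hV) (Real.exp_pos _).le).trans
    (exp_mul_latE_le_transferKernel hβ (wilsonAction_le_of_near_flat U W hflat hU) (wilsonAction_le_of_near_flat V W hflat hV))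

/-! ## §2 The Hilbert–Schmidt box around a configuration and its Haar measure -/

/-- The one-link ball `{g | ‖g − g₀‖_F ≤ r}` is measurable (closed). [folklore] -/
theorem measurableSet_frobBall (g₀ : SU2) (r : ℝ) :
    MeasurableSet {g : SU2 | frobNorm ((g : Matrix (Fin 2) (Fin 2) ℂ) - (g₀ : Matrix (Fin 2) (Fin 2) ℂ)) ≤ r} :=
  (isClosed_le (continuous_frobNorm'.comp (continuous_subtype_val.sub continuous_const)) continuous_const).measurableSet

/-- The box `A_r(W)` is the product of one-link balls. [folklore] -/
theorem box_eq_pi (W : GaugeConfig 3 L SU2) (r : ℝ) :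
    {U : GaugeConfig 3 L SU2 | ∀ e, frobNorm ((U e : Matrix (Fin 2) (Fin 2) ℂ) - (W e : Matrix (Fin 2) (Fin 2) ℂ)) ≤ r} =
      Set.pi Set.univ fun e : Edge 3 L => {g : SU2 | frobNorm ((g : Matrix (Fin 2) (Fin 2) ℂ) - (W e : Matrix (Fin 2) (Fin 2) ℂ)) ≤ r} := by
  ext U; simp

/-- The box `A_r(W)` is measurable. [folklore] -/
theorem measurableSet_box [NeZero L] (W : GaugeConfig 3 L SU2) (r : ℝ) :
    MeasurableSet {U : GaugeConfig 3 L SU2 | ∀ e, frobNorm ((U e : Matrix (Fin 2) (Fin 2) ℂ) - (W e : Matrix (Fin 2) (Fin 2) ℂ)) ≤ r} := by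
  rw [box_eq_pi]
  exact MeasurableSet.univ_pi fun e => measurableSet_frobBall (W e) r

/-- **`Haar^{⊗E}(A_r(W)) = ballVol(r)^{|E|}`** (translation invariance of the Haar volume of a Hilbert–Schmidt ball). [folklore] -/
theorem configMeasure_real_box [NeZero L] (W : GaugeConfig 3 L SU2) (r : ℝ) :
    (configMeasure SU2 L).real {U : GaugeConfig 3 L SU2 | ∀ e, frobNorm ((U e : Matrix (Fin 2) (Fin 2) ℂ) - (W e : Matrix (Fin 2) (Fin 2) ℂ)) ≤ r} =
      ballVol r ^ Fintype.card (Edge 3 L) := by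
  rw [box_eq_pi, Measure.real, configMeasure, Measure.pi_pi, ENNReal.toReal_prod]
  have h : ∀ e : Edge 3 L, ((haarProbability SU2) {g : SU2 | frobNorm ((g : Matrix (Fin 2) (Fin 2) ℂ) - (W e : Matrix (Fin 2) (Fin 2) ℂ)) ≤ r}).toReal
      = ballVol r := fun e => ballVol_shift (W e) r
  simp only [h, Finset.prod_const, Finset.card_univ]

/-! ## §3 Separation: one far link suppresses the electric factor -/

/-- `Re tr(uv⁻¹) = 2 − ‖u − v‖_F²/2` on `SU(2)`. [folklore] -/
theorem re_trace_mul_inv_eq (u v : SU2) :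
    ((su2Rep (u * v⁻¹)).trace).re = 2 - frobNorm ((u : Matrix (Fin 2) (Fin 2) ℂ) - (v : Matrix (Fin 2) (Fin 2) ℂ)) ^ 2 / 2 := by
  rw [fundamentalRep_apply, frobNorm_sub_eq_mul_inv]
  have h := two_sub_re_trace_eq (u * v⁻¹)
  linarith

/-- **Separation bound**: if ONE link has `‖U_{e₀} − V_{e₀}‖_F ≥ ρ` (`ρ ≥ 0`) then `Σ_e Re tr(U_eV_e⁻¹) ≤ 2|E| − ρ²/2`. [folklore] -/
theorem timeCoupling_le_of_far_link [NeZero L] {U V : GaugeConfig 3 L SU2} (e₀ : Edge 3 L) {ρ : ℝ} (hρ : 0 ≤ ρ)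
    (h : ρ ≤ frobNorm ((U e₀ : Matrix (Fin 2) (Fin 2) ℂ) - (V e₀ : Matrix (Fin 2) (Fin 2) ℂ))) :
    timeCoupling su2Rep U V ≤ 2 * (Fintype.card (Edge 3 L) : ℝ) - ρ ^ 2 / 2 := by
  unfold timeCoupling
  have hle : ∀ e : Edge 3 L, ((su2Rep (U e * (V e)⁻¹)).trace).re ≤ 2 := fun e => by
    rw [fundamentalRep_apply]; exact re_trace_le_two _
  have h0 : ((su2Rep (U e₀ * (V e₀)⁻¹)).trace).re ≤ 2 - ρ ^ 2 / 2 := by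
    rw [re_trace_mul_inv_eq]
    have := mul_le_mul h h hρ (frobNorm_nonneg _)
    nlinarith
  rw [← Finset.add_sum_erase _ _ (Finset.mem_univ e₀)]
  have hrest : ∑ e ∈ Finset.univ.erase e₀, ((su2Rep (U e * (V e)⁻¹)).trace).re ≤ ∑ _e ∈ Finset.univ.erase e₀, (2 : ℝ) :=
    Finset.sum_le_sum fun e _ => hle e
  rw [Finset.sum_const, nsmul_eq_mul, Finset.card_erase_of_mem (Finset.mem_univ e₀), Finset.card_univ] at hrest
  have hcard : (1 : ℕ) ≤ Fintype.card (Edge 3 L) := Fintype.card_pos_iff.2 ⟨e₀⟩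
  rw [Nat.cast_sub hcard, Nat.cast_one] at hrest
  linarith

/-- Hence `K_β(U,V) ≤ e^{β(2|E| − ρ²/2)}` once one link is `ρ`-far (`β ≥ 0`). [cite: SeilerLNP1982, §3] -/
theorem transferKernel_le_of_far_link [NeZero L] {β : ℝ} (hβ : 0 ≤ β) {U V : GaugeConfig 3 L SU2} (e₀ : Edge 3 L) {ρ : ℝ} (hρ : 0 ≤ ρ)
    (h : ρ ≤ frobNorm ((U e₀ : Matrix (Fin 2) (Fin 2) ℂ) - (V e₀ : Matrix (Fin 2) (Fin 2) ℂ))) :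
    transferKernel su2Rep β U V ≤ Real.exp (β * (2 * (Fintype.card (Edge 3 L) : ℝ) - ρ ^ 2 / 2)) := by
  refine (transferKernel_le_latE hβ U V).trans ?_
  rw [latE_eq_exp]
  exact Real.exp_le_exp.2 (mul_le_mul_of_nonneg_left (timeCoupling_le_of_far_link e₀ hρ h) hβ)

/-! ## §4 The flat sheet configuration -/

/-- `‖diag(i,−i) − 1‖_F = 2`. [folklore] -/
theorem frobNorm_diagSU2_half_pi_sub_one : frobNorm (((diagSU2 (π / 2) : SU2) : Matrix (Fin 2) (Fin 2) ℂ) - 1) = 2 := by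
  have hsq : frobNorm (((diagSU2 (π / 2) : SU2) : Matrix (Fin 2) (Fin 2) ℂ) - 1) ^ 2 = 2 ^ 2 := by
    rw [frobNorm_diagSU2_sub_one_sq, Real.cos_pi_div_two]; norm_num
  exact (sq_eq_sq₀ (frobNorm_nonneg _) (by norm_num)).1 hsq

/-- `diag(i,−i)` is at Hilbert–Schmidt distance `2` from BOTH centre elements: `vacDist (diagSU2 (π/2)) = 2`. [folklore] -/
theorem vacDist_diagSU2_half_pi : vacDist (diagSU2 (π / 2)) = 2 := by
  have ha := frobNorm_diagSU2_half_pi_sub_one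
  have hb : frobNorm (((diagSU2 (π / 2) : SU2) : Matrix (Fin 2) (Fin 2) ℂ) + 1) = 2 := by
    have h8 := frobNorm_add_one_sq_eq (diagSU2 (π / 2))
    rw [ha] at h8
    have hsq : frobNorm (((diagSU2 (π / 2) : SU2) : Matrix (Fin 2) (Fin 2) ℂ) + 1) ^ 2 = 2 ^ 2 := by rw [h8]; norm_num
    exact (sq_eq_sq₀ (frobNorm_nonneg _) (by norm_num)).1 hsq
  unfold vacDist
  rw [ha, hb, min_self]

/-- `sheetCfg` evaluated. [folklore] -/
theorem sheetCfg_apply (e : Edge 3 L) : sheetCfg L e = if e.2 = 0 ∧ e.1 0 = 0 then diagSU2 (π / 2) else 1 := by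
  unfold sheetCfg twist
  simp only [Pi.one_apply, mul_one]

/-- Shifting a site in a direction `j ≠ 0` does not change its `0`-th coordinate. [folklore] -/
theorem shift_apply_zero_of_ne (x : Site 3 L) {j : Fin 3} (hj : j ≠ 0) : (x.shift j) 0 = x 0 := by
  simp only [Site.shift, Pi.add_apply, Pi.single_apply, if_neg (Ne.symm hj), add_zero]

/-- ★ **The sheet configuration is flat**: every plaquette holonomy of `sheetCfg L` is `1` (the two `x`-links of an `(0,j)`-plaquette both lie on
the sheet or both off it, and the links between them are `1`). [cite: Luscher1983, §2] -/
theorem plaquetteHolonomy_sheetCfg (x : Site 3 L) (i j : Fin 3) : plaquetteHolonomy (sheetCfg L) x i j = 1 := by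
  by_cases hij : i = j
  · subst hij; exact plaquetteHolonomy_self _ _ _
  simp only [plaquetteHolonomy, sheetCfg_apply]
  by_cases hi : i = 0
  · subst hi
    have hj : j ≠ 0 := fun h => hij h.symm
    simp only [true_and, hj, false_and, if_false, shift_apply_zero_of_ne x hj, mul_one, inv_one]
    split_ifs <;> simp
  · by_cases hj : j = 0
    · subst hj
      simp only [hi, false_and, if_false, true_and, shift_apply_zero_of_ne x hi, one_mul, inv_one, mul_one]
      split_ifs <;> simp
    · simp [hi, hj]

/-- On the box `A_r(sheetCfg L) × A_r(sheetCfg L)` the transfer kernel is `≥ e^{−β·8r²|P|} · e^{β(2−2r²)|E|}`. [cite: SeilerLNP1982, §3] -/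
theorem transferKernel_ge_of_near_sheet [NeZero L] {β : ℝ} (hβ : 0 ≤ β) {r : ℝ} {U V : GaugeConfig 3 L SU2}
    (hU : ∀ e, frobNorm ((U e : Matrix (Fin 2) (Fin 2) ℂ) - (sheetCfg L e : Matrix (Fin 2) (Fin 2) ℂ)) ≤ r)
    (hV : ∀ e, frobNorm ((V e : Matrix (Fin 2) (Fin 2) ℂ) - (sheetCfg L e : Matrix (Fin 2) (Fin 2) ℂ)) ≤ r) :
    Real.exp (-(β * (8 * r ^ 2 * Fintype.card (Plaquette 3 L)))) * Real.exp (β * (2 - 2 * r ^ 2)) ^ Fintype.card (Edge 3 L) ≤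
      transferKernel su2Rep β U V :=
  transferKernel_ge_of_near_flat hβ (plaquetteHolonomy_sheetCfg (L := L)) hU hV

end FlatSheet

end Summit.QuantumFields.YangMills.Theorems.FemtoTransferGap

end
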